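import Summits.Langlands.Langlands.Theorems.HalfIntegralTwistCM.Negative.ArchParameterGLOne
import HarnessLib

/-!
# `HalfIntegralTwistCM` (stmt-Langlands-14036) — negative knowledge III: hypothesis (ii) is load-bearing

Sorry-free (cdisprove cycle 1). The crux with hypothesis (ii) `s₁ ι - s₁ ῑ ∈ ℤ` dropped is FALSE,
kernel-checked MODULO the named fact `Patrikis2019_heckeCharacter_archType_iff_units` (Weil 1956 /
Patrikis 2019 Lemma 2.1.1, direction "unit condition ⇒ existence" — the same input the positive proof
consumes): `halfIntegralTwistCM_false_without_conjInt`. Witness `K = ℚ(ζ₃)` (CM, finite unit group, so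
Weil's unit condition for the angular type `m ≡ 1` holds with exponent `M = |𝓞_Kˣ|`), `ω = π_ψ` with
`ψ_∞(z) = z/|z|` (parameter `(p, q)`, `p - q = 1`), `s₁ = s₂ = (p/2, q/2)`: (i), (iii), (iv) hold,
(ii) fails by `1/2`, and a re-twist would violate `P σ - P σ̄ ∈ ℤ` (file `ArchParameterGLOne`).
[folklore]
-/

noncomputable section

open scoped MatrixGroups Matrix Classical NumberField ComplexConjugate
open NumberField NumberField.InfinitePlace NumberField.mixedEmbedding IsDedekindDomain

namespace Summit.Langlands.Langlands.Theorems.HalfIntegralTwistCM.Negative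

open Literature.NumberTheory.Automorphic
open Literature.NumberTheory.GaloisRepresentations

variable {K : Type} [Field K] [NumberField K] {hcpt : isCompact_glFiniteIntegralLevel 1 K}

/-- **The parity obstruction.** If a `GL₁` datum `χ` over `K` has parameter `ι ↦ {P ι}` and, at a
complex place `w`, `P σ_w + e₁/2` and `P σ̄_w + e₂/2` are both in `1/2 + ℤ` while `e₁ - e₂` is an ODD
integer, contradiction (`P σ_w - P σ̄_w ∈ ℤ` by `archParam_embedding_sub_conj_mem_int_glOne`).
[folklore] -/
theorem no_halfIntegralTwist_of_odd
    (χ : AutomorphicRepData (AutomorphyDatum.gl 1 K hcpt)) {P : (K →+* ℂ) → ℂ}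
    (hP : χ.HasArchParameter fun ι => {P ι}) (w : {w : InfinitePlace K // w.IsComplex})
    {e₁ e₂ : ℂ} {k : ℤ} (hodd : e₁ - e₂ = 2 * k + 1)
    (h₁ : ∃ m : ℤ, P w.1.embedding + e₁ / 2 - 1 / 2 = m)
    (h₂ : ∃ m : ℤ, P (ComplexEmbedding.conjugate w.1.embedding) + e₂ / 2 - 1 / 2 = m) : False := by
  obtain ⟨p, q, n, hp, hq, hn⟩ := archParam_embedding_sub_conj_mem_int_glOne χ hP w
  obtain ⟨m₁, hm₁⟩ := h₁
  obtain ⟨m₂, hm₂⟩ := h₂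
  have hp' : P w.1.embedding = p := Multiset.singleton_inj.1 hp
  have hq' : P (ComplexEmbedding.conjugate w.1.embedding) = q := Multiset.singleton_inj.1 hq
  rw [hp'] at hm₁
  rw [hq'] at hm₂
  have key : (2 : ℂ) * (m₁ - m₂ - n - k) = 1 := by
    linear_combination -2 * hm₁ + 2 * hm₂ + 2 * hn + hodd
  have key' : (2 * (m₁ - m₂ - n - k) : ℤ) = 1 := by exact_mod_cast key
  omega

/-! ### The witness field `ℚ(ζ₃)` -/

/-- The third cyclotomic field `ℚ(ζ₃) = ℚ(√-3)`. [folklore] -/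
abbrev K₃ : Type := CyclotomicField 3 ℚ

/-- `ℚ(ζ₃)/ℚ` is the cyclotomic extension of level `3` (Mathlib's instance, named). [folklore] -/
theorem isCyclotomicExtension_K₃ : IsCyclotomicExtension {3} ℚ K₃ :=
  CyclotomicField.isCyclotomicExtension 3 ℚ


/-- `ℚ(ζ₃)` is a CM field (Mathlib: a nontrivial cyclotomic extension of `ℚ` is CM). [folklore] -/
theorem isCMField_K₃ : NumberField.IsCMField K₃ :=
  haveI := isCyclotomicExtension_K₃
  IsCyclotomicExtension.Rat.isCMField K₃ (S := {3}) ⟨3, Set.mem_singleton 3, by norm_num⟩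

/-- `ℚ(ζ₃)` has unit rank `0` (one complex place). [folklore] -/
theorem units_rank_K₃ : NumberField.Units.rank K₃ = 0 := by
  haveI := isCyclotomicExtension_K₃
  dsimp only [NumberField.Units.rank]
  rw [card_eq_nrRealPlaces_add_nrComplexPlaces,
    IsCyclotomicExtension.Rat.nrRealPlaces_eq_zero (n := 3) K₃ (by decide), zero_add,
    IsCyclotomicExtension.Rat.nrComplexPlaces_eq_totient_div_two (n := 3)]
  rfl

/-- **A uniform exponent for the units of `ℚ(ζ₃)`**: `u^M = 1` for all `u ∈ 𝓞_Kˣ` with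
`M = |torsion| (= 6)` — the unit group is finite (rank `0`, Dirichlet). [folklore] -/
theorem exists_units_pow_eq_one_K₃ : ∃ M : ℕ, 0 < M ∧ ∀ u : (𝓞 K₃)ˣ, u ^ M = 1 := by
  refine ⟨Nat.card (NumberField.Units.torsion K₃), Nat.card_pos, fun u => ?_⟩
  obtain ⟨⟨x, e⟩, hxu, -⟩ := NumberField.Units.exist_unique_eq_mul_prod _ u
  replace hxu : u = x := by
    rw [← mul_one x.1, hxu]
    apply congr_arg
    rw [← Finset.prod_empty]
    congr
    rw [Finset.univ_eq_empty_iff, units_rank_K₃]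
    infer_instance
  have h := pow_card_eq_one' (G := NumberField.Units.torsion K₃) (x := x)
  rw [hxu]
  exact_mod_cast congrArg Subtype.val h

/-- **Weil's unit condition holds for the angular type `m ≡ 1`, `t ≡ 0` over `ℚ(ζ₃)`**:
`(∏_w ι_w(u)/|ι_w(u)|)^M = 1` for all units `u`, with `M` as above. [folklore] -/
theorem unitCondition_K₃ : ∃ M : ℕ, 0 < M ∧ ∀ α : (𝓞 K₃)ˣ,
    (∏ w : InfinitePlace K₃, archUnitaryValue ((fun _ => (1 : ℤ)) w) ((fun _ => (0 : ℝ)) w)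
      (w.embedding ((α : 𝓞 K₃) : K₃))) ^ M = 1 := by
  obtain ⟨M, hM, hu⟩ := exists_units_pow_eq_one_K₃
  refine ⟨M, hM, fun α => ?_⟩
  rw [← Finset.prod_pow]
  refine Finset.prod_eq_one fun w _ => ?_
  have hz : w.embedding ((α : 𝓞 K₃) : K₃) ≠ 0 := by
    rw [map_ne_zero]
    exact_mod_cast α.ne_zero
  have hαM : (w.embedding ((α : 𝓞 K₃) : K₃)) ^ M = 1 := by
    rw [← map_pow]
    have : (((α : 𝓞 K₃) : K₃)) ^ M = 1 := by
      have h := hu α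
      rw [Units.ext_iff, Units.val_pow_eq_pow_val, Units.val_one] at h
      exact_mod_cast congrArg (algebraMap (𝓞 K₃) K₃) h
    rw [this, map_one]
  unfold archUnitaryValue
  rw [zpow_one, Complex.ofReal_zero, zero_mul, Complex.cpow_zero, mul_one, div_pow, hαM,
    ← Complex.ofReal_pow, ← norm_pow, hαM, norm_one, Complex.ofReal_one, div_one]

/-- **Hypothesis (ii) is load-bearing: the crux WITHOUT (ii) is FALSE** (modulo Weil's unit criterion
`Patrikis2019_heckeCharacter_archType_iff_units`, the named fact the positive proof also consumes).
Witness `K = ℚ(ζ₃)`, `ω = π_ψ` with `ψ_∞ = z/|z|`, `s₁ = s₂ = (p/2, q/2)`, `p - q = 1`; see the section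
docstring. Any proof of the crux must therefore USE (ii). [cite: Patrikis2019, Lemma 2.1.1] -/
theorem halfIntegralTwistCM_false_without_conjInt (hW : Patrikis2019_heckeCharacter_archType_iff_units) :
    ¬ (∀ (K : Type) [Field K] [NumberField K], NumberField.IsCMField K →
        ∀ (h1 : Literature.NumberTheory.Automorphic.isCompact_glFiniteIntegralLevel 1 K)
          (s₁ s₂ : (K →+* ℂ) → ℂ), (∀ ι, ∃ k : ℤ, s₁ ι - s₂ ι = k) →
          (∀ ι, ∃ m : ℤ, (s₁ ι - s₂ ι) + (s₁ (NumberField.ComplexEmbedding.conjugate ι) -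
            s₂ (NumberField.ComplexEmbedding.conjugate ι)) = 2 * m) →
          (∃ ω : Literature.NumberTheory.Automorphic.CuspidalAutomorphicRepData 1 K h1,
            ω.1.HasArchParameter (fun ι => {s₁ ι + s₂ ι})) →
          ∃ (χ : Literature.NumberTheory.Automorphic.CuspidalAutomorphicRepData 1 K h1)
            (p : (K →+* ℂ) → ℂ), χ.1.HasArchParameter (fun ι => {p ι}) ∧
              ∀ ι, ∃ m : ℤ, p ι + s₁ ι - 1 / 2 = m) := by
  intro hC
  -- the Hecke character `ψ` of `ℚ(ζ₃)` with `ψ_∞(z) = z/|z|` (Weil)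
  obtain ⟨ψ, -, hψ⟩ := (hW K₃ (fun _ => 1) (fun _ => 0)).2 unitCondition_K₃
  set h1 : isCompact_glFiniteIntegralLevel 1 K₃ := isCompact_glFiniteIntegralLevel_holds 1 K₃ with hh1
  -- its datum `π_ψ = ℂ·(ψ∘det)/⊥`, cuspidal (no parabolic condition in rank one)
  obtain ⟨τ, hτW, hτW'⟩ := exists_automorphicRepData_detTwist_glOne h1 ψ
  have hcusp : τ.W ≤ cuspFormsGL 1 K₃ h1 := by
    rw [hτW, Submodule.span_le]
    rintro _ rfl
    exact IsCuspFormGL.mem_cuspFormsGL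
      ⟨isAutomorphicForm_detTwist_glOne h1 ψ, fun k hk hk1 => absurd hk1 (by omega)⟩
  have hχτ := detTwist_datum_heckeCharacter (hcpt := h1) (θ := ψ) hτW
  -- its archimedean parameter `E`: singletons, with `p - q = 1` at the complex place
  obtain ⟨E, hE⟩ := τ.exists_hasArchParameter_glOne
  haveI : NumberField.IsCMField K₃ := isCMField_K₃
  have hsing : ∀ ι : K₃ →+* ℂ, ∃ x : ℂ, E ι = {x} := by
    intro ι
    have hw : (InfinitePlace.mk ι).IsComplex := NumberField.IsTotallyComplex.isComplex _
    obtain ⟨p, q, -, hp, hq, -⟩ :=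
      archParam_embedding_sub_conj_mem_int_glOne τ hE ⟨InfinitePlace.mk ι, hw⟩
    have hp' : E (InfinitePlace.mk ι).embedding = {p} := hp
    have hq' : E (ComplexEmbedding.conjugate (InfinitePlace.mk ι).embedding) = {q} := hq
    rcases InfinitePlace.mk_eq_iff.mp (InfinitePlace.mk_embedding (InfinitePlace.mk ι)) with hι | hι
    · rw [hι] at hp'
      exact ⟨p, hp'⟩
    · rw [hι] at hq'
      exact ⟨q, hq'⟩
  choose e he using hsing
  have hEe : E = fun ι => {e ι} := funext he
  -- the exponents `s₁ = s₂ = e/2`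
  have hmain := hC K₃ isCMField_K₃ h1 (fun ι => e ι / 2) (fun ι => e ι / 2)
    (fun ι => ⟨0, by simp⟩) (fun ι => ⟨0, by simp⟩)
    ⟨⟨τ, hcusp⟩, by
      have : (fun ι : K₃ →+* ℂ => ({e ι / 2 + e ι / 2} : Multiset ℂ)) = E := by
        rw [hEe]; funext ι; congr 1; ring
      rw [this]; exact hE⟩
  obtain ⟨χ, P, hP, hint⟩ := hmain
  -- a complex place `w` and the parity contradiction
  obtain ⟨w⟩ : Nonempty {w : InfinitePlace K₃ // w.IsComplex} := by
    let ι : K₃ →+* ℂ := Classical.choice (inferInstance : Nonempty _)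
    exact ⟨⟨InfinitePlace.mk ι, NumberField.IsTotallyComplex.isComplex _⟩⟩
  obtain ⟨p, q, hp, hq, hpq⟩ := archParam_sub_conj_eq_of_hasUnitaryArchType τ hχτ hψ hE w
  have hep : e w.1.embedding = p := Multiset.singleton_inj.1 ((he _).symm.trans hp)
  have heq : e (ComplexEmbedding.conjugate w.1.embedding) = q :=
    Multiset.singleton_inj.1 ((he _).symm.trans hq)
  refine no_halfIntegralTwist_of_odd χ.1 hP w (e₁ := e w.1.embedding)
    (e₂ := e (ComplexEmbedding.conjugate w.1.embedding)) (k := 0) ?_ (hint _) (hint _)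
  rw [hep, heq, hpq]
  push_cast
  ring

end Summit.Langlands.Langlands.Theorems.HalfIntegralTwistCM.Negative
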